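import Mathlib
import Summits.Ventures.PercRepro2.PMK5Deg3Kernel
import Summits.Ventures.PercRepro2.PMK5Deg4Kernel
import Summits.Ventures.PercRepro2.PMK5Deg4Kernel5
import Summits.Ventures.PercRepro2.PMK5Deg4LitsOA1UB0
import Summits.Ventures.PercRepro2.PMK5Deg4LitsOA1UB1
import Summits.Ventures.PercRepro2.PMK5Deg4LitsOA1UB2
import Summits.Ventures.PercRepro2.PMK5Deg4LitsOA1UB3

/-!
# The table literals of the quadruple `(0, 1, 3, 4)`, five sliced edges, and their kernel certification, part 4 of 0–4
(blind cell PercRepro2, mine-2 g29; the degree-4 rung, `PMK5Deg4Kernel5.lean`)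

`Loa1ub i a b c d e` is the `512`-bit vector of the `i`-th of the nineteen tables of `K₅ + {a₃0, a₃1, a₃3, a₃4}` restricted to
the edges `9 ↦ a`, `10 ↦ b`, `11 ↦ c`, `12 ↦ d`, `13 ↦ e` (bit `idx2 ω` = the table at `ext5 ω a b c d e`), generated by
mining/mine-2/code/g29/lits5.c.  **`litOK_oa1ub : LitOK 0 1 3 4 Loa1ub`** (part 4) certifies all `608` literals against the
tables in the kernel (`lit_oa1ub_fffff`, …, `lit_oa1ub_ttttt`: one `decide +kernel` per restriction, the bit tree `bits9` evaluated on
the `512` nine-edge configurations of each; part 0 = the literals (statement-only), parts 1–4 = eight certifications each).  The `1024` slice certificates `CertS Loa1ub j₁ … j₅` are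
`PMK5Deg4CertsOA1UB*.lean`.
-/

namespace Summit.Ventures.PercRepro2

namespace Deg4

namespace Five

set_option maxHeartbeats 0 in
set_option maxRecDepth 100000 in
/-- The literals of the restriction `ffftt` are the bit vectors of the restricted tables. -/
theorem lit_oa1ub_ffftt : ∀ i : Fin 19, Loa1ub i false false false true true = bits9 (res5 (tab 0 1 3 4 i) false false false true true) := by
  decide +kernel

set_option maxHeartbeats 0 in
set_option maxRecDepth 100000 in
/-- The literals of the restriction `tfftt` are the bit vectors of the restricted tables. -/
theorem lit_oa1ub_tfftt : ∀ i : Fin 19, Loa1ub i true false false true true = bits9 (res5 (tab 0 1 3 4 i) true false false true true) := by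
  decide +kernel

set_option maxHeartbeats 0 in
set_option maxRecDepth 100000 in
/-- The literals of the restriction `ftftt` are the bit vectors of the restricted tables. -/
theorem lit_oa1ub_ftftt : ∀ i : Fin 19, Loa1ub i false true false true true = bits9 (res5 (tab 0 1 3 4 i) false true false true true) := by
  decide +kernel

set_option maxHeartbeats 0 in
set_option maxRecDepth 100000 in
/-- The literals of the restriction `ttftt` are the bit vectors of the restricted tables. -/
theorem lit_oa1ub_ttftt : ∀ i : Fin 19, Loa1ub i true true false true true = bits9 (res5 (tab 0 1 3 4 i) true true false true true) := by
  decide +kernel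

set_option maxHeartbeats 0 in
set_option maxRecDepth 100000 in
/-- The literals of the restriction `ffttt` are the bit vectors of the restricted tables. -/
theorem lit_oa1ub_ffttt : ∀ i : Fin 19, Loa1ub i false false true true true = bits9 (res5 (tab 0 1 3 4 i) false false true true true) := by
  decide +kernel

set_option maxHeartbeats 0 in
set_option maxRecDepth 100000 in
/-- The literals of the restriction `tfttt` are the bit vectors of the restricted tables. -/
theorem lit_oa1ub_tfttt : ∀ i : Fin 19, Loa1ub i true false true true true = bits9 (res5 (tab 0 1 3 4 i) true false true true true) := by
  decide +kernel

set_option maxHeartbeats 0 in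
set_option maxRecDepth 100000 in
/-- The literals of the restriction `ftttt` are the bit vectors of the restricted tables. -/
theorem lit_oa1ub_ftttt : ∀ i : Fin 19, Loa1ub i false true true true true = bits9 (res5 (tab 0 1 3 4 i) false true true true true) := by
  decide +kernel

set_option maxHeartbeats 0 in
set_option maxRecDepth 100000 in
/-- The literals of the restriction `ttttt` are the bit vectors of the restricted tables. -/
theorem lit_oa1ub_ttttt : ∀ i : Fin 19, Loa1ub i true true true true true = bits9 (res5 (tab 0 1 3 4 i) true true true true true) := by
  decide +kernel

/-- **The table literals of the quadruple `(0, 1, 3, 4)` are correct.** -/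
theorem litOK_oa1ub : LitOK 0 1 3 4 Loa1ub := by
  intro i a b c d e
  cases a <;> cases b <;> cases c <;> cases d <;> cases e
  · exact lit_oa1ub_fffff i
  · exact lit_oa1ub_fffft i
  · exact lit_oa1ub_ffftf i
  · exact lit_oa1ub_ffftt i
  · exact lit_oa1ub_fftff i
  · exact lit_oa1ub_fftft i
  · exact lit_oa1ub_ffttf i
  · exact lit_oa1ub_ffttt i
  · exact lit_oa1ub_ftfff i
  · exact lit_oa1ub_ftfft i
  · exact lit_oa1ub_ftftf i
  · exact lit_oa1ub_ftftt i
  · exact lit_oa1ub_fttff i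
  · exact lit_oa1ub_fttft i
  · exact lit_oa1ub_ftttf i
  · exact lit_oa1ub_ftttt i
  · exact lit_oa1ub_tffff i
  · exact lit_oa1ub_tffft i
  · exact lit_oa1ub_tfftf i
  · exact lit_oa1ub_tfftt i
  · exact lit_oa1ub_tftff i
  · exact lit_oa1ub_tftft i
  · exact lit_oa1ub_tfttf i
  · exact lit_oa1ub_tfttt i
  · exact lit_oa1ub_ttfff i
  · exact lit_oa1ub_ttfft i
  · exact lit_oa1ub_ttftf i
  · exact lit_oa1ub_ttftt i
  · exact lit_oa1ub_tttff i
  · exact lit_oa1ub_tttft i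
  · exact lit_oa1ub_ttttf i
  · exact lit_oa1ub_ttttt i

end Five

end Deg4

end Summit.Ventures.PercRepro2
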